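/-
Copyright: public-domain mathematics; typed transcription for the H21 Literature library (cell lit-balaban,
reader/typer seat r02 gen 5 = literature-prover-lit-balaban-r02-g5-0).

statement-level skeleton of published theorems with citation tags; proofs where landed; nothing here is a claim about the Yang–Mills mass gap

# Bałaban, *Propagators and renormalization transformations for lattice gauge theories. I*,
# Commun. Math. Phys. **95** (1984) 17–40 — "PROPOSITION 1.1 FOR G₀" (p. 39) FOR THE TOWER FAMILY OF RECORD `famG0Top`
# (census (iv) `h11G0` of the Prop-1.2 chain), BY NAME: `B5.Prop11Printed (B5G0SettingTorus.famG0Top d L a 0)`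

[cite: Balaban1984PropagatorsI]  T. Bałaban, Commun. Math. Phys. 95 (1984) 17–40.  p. 39 (PDF p. 23) L27–29 (text-layer count,
L1 = running head; v1.1 wrote "L21–23" — r05 25-(a)), verbatim: «… and G₀J = a⁻¹J for
J constant, hence by the first two terms in the representation (1.81). Thus its momentum representation is given by (1.87) and we
have Proposition 1.1 for G₀.»; p. 33 Prop. 1.1 (1.89)–(1.90).  (v1.1 DOCSTRING-ONLY, r02 gen 12 QUOTE-AUDIT-B5 item A2: v1 wrote
"Proposition 1.1 holds for G₀ also, so we have to prove …" inside guillemets — a paraphrase, NOT the printed wording; the printed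
sentence is the one now quoted; declarations byte-identical to v1.)  (v1.2 DOCSTRING-ONLY, r02 gen 13, QUOTE-AUDIT-B5 §E/§G G1: p. 39
line numerals counted; our located leaf `‖J‖ ≤ B|J|` (l.28/321/355 of v1.1) and two cell labels taken out of guillemets — guillemets in
this file = verbatim print only; declarations byte-identical.)

WHAT THIS MODULE ADDS (SKELETON rows B5.Eq1.134 ("Prop. 1.1 for G₀"), B5.Prop1.2 census (iv)).  p251794 proved Prop. 1.1 for
`G₀ = (Δ + aQ*Q)^{−1}` in the product-torus typing (`B5Prop11G0Torus.l2opG0_le`, `ineq190_G0_form`, constant `gammaG0 d a`);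
`B5G0BridgeP12`/`B5G0BridgeP12Norms` carried it to p37's tower operators (`towerG0_ineq189_0…5`, `towerG0_ineq190`).  Here the last
step: p37's G₀-SETTING OF RECORD `B5G0SettingTorus.g0Setting P a 0 P.K μ` (member `(P, μ)`: the scalar operator `G₀^{(μ)}` on every
component of a vector source, weighted norms `l2Fam`, forms `formOp`) —
* §1 single-component sources `Pi.single μ f` through the tower shorthands (`tG0_single`, `tD_single`, `tDiv_single`, `tl2_single`,
  `tl2T_single`, `dot_single_sum`); `l2Fam_le_of_sq` (weights cancel);
* §2 the scalar bounds for `G₀^{(μ)}`: `opL2_n_le` for n = 0…5 and the form inequality `formOp_ineq190`;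
* §3 **`prop11_g0Setting`, `prop11Printed_famG0Top : B5.Prop11Printed (famG0Top d L a 0)`** (`a > 0`, one `γ₀ = gammaG0 d a`
  for all tori of dimension `d` and all directions) — the hypothesis `h11G0` of `B5.prop12G0_of_printed_steps` /
  `B5Prop12GpTorus.prop12G0_of_torusGp` DISCHARGED for the family of record;
* §4 the located leaf `‖J‖ ≤ B|J|` for `supp J ⊂ Δ̃(y′)` of `B5Transfer133.CarrierFacts.l2_le_sup` for the TOWER settings at the top
  level (`l2NormV_le_supNormV`, `l2_le_sup_opSetting`, B = √(d³3^d) uniform), transported from `B5SettingP12Weighted.l2NormW_le_supNorm`.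

HONEST SCOPE.  Transport only: the analysis is p251794's (Fourier/Plancherel on the product torus); DIVERGENCE inherited from p37's
setting: its sixth norm (‖G₀∇*∇*J‖, 2-tensor sources) is set to 0 there, so that member of (1.89) is vacuous here (it is proved in
the product typing, `towerG0_ineq189_5`).
-/
import Mathlib
import Literature.MathematicalPhysics.QuantumFieldTheory.Balaban1983to89.B5G0BridgeP12Norms
import Literature.MathematicalPhysics.QuantumFieldTheory.Balaban1983to89.B5G0SettingTorus

open scoped BigOperators Matrix Real
open Finset Matrix

namespace Literature.MathematicalPhysics.QuantumFieldTheory.Balaban1983to89.B5Prop11G0Tower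

open Literature.MathematicalPhysics.QuantumFieldTheory.Balaban1983to89
open Literature.MathematicalPhysics.QuantumFieldTheory.Balaban1983to89.B5SiteBridgeP12 (nP MP)
open Literature.MathematicalPhysics.QuantumFieldTheory.Balaban1983to89.B5G0BridgeP12 (tl2 tl2T tG0 tD tDiv towerG0_ineq189_0
  towerG0_ineq189_1 towerG0_ineq189_2 towerG0_ineq189_3 towerG0_ineq189_4 towerG0_ineq190 gammaG0_pos')
open Literature.MathematicalPhysics.QuantumFieldTheory.Balaban1983to89.B5Eq133G0Torus (G0 M0)
open Literature.MathematicalPhysics.QuantumFieldTheory.Balaban1983to89.B5G0SettingTorus (dEta lapEta dEta_top lapEta_top opDiv opDD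
  opK1 opKDD l2Fam l2Fam_nonneg opL2 formOp g0Setting famG0Top G0TopIdx)
open Literature.MathematicalPhysics.QuantumFieldTheory.Balaban1983to89.B5GpSettingTorus (l2NormV)
open Literature.MathematicalPhysics.QuantumFieldTheory.Balaban1983to89.B1RG242Torus (deriv hOp H)
open Literature.MathematicalPhysics.QuantumFieldTheory.Balaban1983to89.B5Prop11G0Torus (gammaG0)

noncomputable section

variable (P : Params)

/-! ## §1 Single-component sources -/

/-- `G *ᵥ Σ = Σ G *ᵥ`. [folklore] -/
private theorem mulVec_finset_sum {m ι : Type*} [Fintype m] (G : Matrix m m ℝ) (s : Finset ι) (v : ι → m → ℝ) :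
    G *ᵥ (∑ i ∈ s, v i) = ∑ i ∈ s, G *ᵥ v i := by
  have h := map_sum (Matrix.mulVecLin G) v s
  simp only [Matrix.mulVecLin_apply] at h
  exact h

/-- `G₀` on a single-component source. [cite: Balaban1984PropagatorsI, (1.132) p.39] -/
theorem tG0_single (a : ℝ) (μ : Fin P.d) (f : Site P 0 → ℝ) :
    tG0 P a (Pi.single μ f) = Pi.single μ (G0 P a 0 P.K μ *ᵥ f) := by
  funext μ'
  by_cases h : μ' = μ
  · subst h; simp [tG0]
  · simp [tG0, Pi.single_eq_of_ne h]

/-- `∂_ν` on a single-component function. [cite: Balaban1984PropagatorsI, (1.31) p.23] -/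
theorem tD_single (ν μ : Fin P.d) (g : Site P 0 → ℝ) :
    tD P ν (Pi.single μ g) = Pi.single μ (deriv P 0 P.eps ν *ᵥ g) := by
  funext μ'
  by_cases h : μ' = μ
  · subst h; simp [tD]
  · simp [tD, Pi.single_eq_of_ne h]

/-- `∇*` of a tensor source concentrated on one second index. [cite: Balaban1984PropagatorsI, (1.89) p.33] -/
theorem tDiv_single (μ : Fin P.d) (J : Fin P.d → Site P 0 → ℝ) :
    tDiv P (fun ν => Pi.single μ (J ν)) = Pi.single μ (∑ ν, (deriv P 0 P.eps ν)ᵀ *ᵥ J ν) := by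
  funext μ' x
  rw [tDiv, Finset.sum_apply, Finset.sum_apply]
  by_cases h : μ' = μ
  · subst h
    simp only [Pi.single_eq_same, Finset.sum_apply]
  · simp only [Pi.single_eq_of_ne h, Matrix.mulVec_zero, Pi.zero_apply, Finset.sum_const_zero]

/-- `tl2` of a single-component function. [cite: Balaban1984PropagatorsI, (1.89) p.33] -/
theorem tl2_single (μ : Fin P.d) (g : Site P 0 → ℝ) : tl2 P (Pi.single μ g) = Real.sqrt (∑ x, g x ^ 2) := by
  unfold tl2
  congr 1
  rw [Finset.sum_eq_single μ]
  · simp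
  · intro μ' _ h
    simp [Pi.single_eq_of_ne h]
  · simp

/-- `tl2T` of a family of single-component functions. [cite: Balaban1984PropagatorsI, (1.89) p.33] -/
theorem tl2T_single {S : Type*} [Fintype S] (μ : Fin P.d) (F : S → Site P 0 → ℝ) :
    tl2T P (fun s => Pi.single μ (F s)) = Real.sqrt (∑ s, ∑ x, F s x ^ 2) := by
  unfold tl2T
  congr 1
  refine Finset.sum_congr rfl fun s _ => ?_
  rw [Finset.sum_eq_single μ]
  · simp
  · intro μ' _ h
    simp [Pi.single_eq_of_ne h]
  · simp

/-- a sum of quadratic forms over the components of a single-component function. [cite: Balaban1984PropagatorsI, (1.90) p.33] -/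
theorem dot_single_sum (μ : Fin P.d) (f : Site P 0 → ℝ) (B : Fin P.d → Matrix (Site P 0) (Site P 0) ℝ) :
    ∑ μ', (Pi.single μ f : Fin P.d → Site P 0 → ℝ) μ' ⬝ᵥ (B μ' *ᵥ (Pi.single μ f : Fin P.d → Site P 0 → ℝ) μ')
      = f ⬝ᵥ (B μ *ᵥ f) := by
  rw [Finset.sum_eq_single μ]
  · simp
  · intro μ' _ h
    simp [Pi.single_eq_of_ne h]
  · simp

/-- from `√X ≤ c·√Y` to `X ≤ c²·Y`. [folklore] -/
private theorem sq_le_of_sqrt_le {X Y c : ℝ} (hX : 0 ≤ X) (hY : 0 ≤ Y)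
    (h : Real.sqrt X ≤ c * Real.sqrt Y) : X ≤ c ^ 2 * Y := by
  have h2 : Real.sqrt X ^ 2 ≤ (c * Real.sqrt Y) ^ 2 := pow_le_pow_left₀ (Real.sqrt_nonneg _) h 2
  rwa [Real.sq_sqrt hX, mul_pow, Real.sq_sqrt hY] at h2

/-- **the weights cancel**: `Σ_iΣ_x F² ≤ c²·Σ_jΣ_x G²` gives `l2Fam k F ≤ c·l2Fam k G`. [cite: Balaban1984PropagatorsI, (1.89) p.33, (1.21) p.21] -/
theorem l2Fam_le_of_sq (k : ℕ) {ι κ : Type} [Fintype ι] [Fintype κ] (F : ι → Site P 0 → ℝ) (G : κ → Site P 0 → ℝ)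
    {c : ℝ} (hc : 0 ≤ c) (h : ∑ i, ∑ x, F i x ^ 2 ≤ c ^ 2 * ∑ j, ∑ x, G j x ^ 2) :
    l2Fam P k F ≤ c * l2Fam P k G := by
  unfold l2Fam
  have hw : 0 ≤ (((P.L : ℝ) ^ k)⁻¹) ^ P.d := by positivity
  have e1 : ∀ {α : Type} [Fintype α] (H : α → Site P 0 → ℝ),
      ∑ i, ∑ x, (((P.L : ℝ) ^ k)⁻¹) ^ P.d * H i x ^ 2 = (((P.L : ℝ) ^ k)⁻¹) ^ P.d * ∑ i, ∑ x, H i x ^ 2 := by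
    intro α _ H
    rw [Finset.mul_sum]
    exact Finset.sum_congr rfl fun i _ => by rw [Finset.mul_sum]
  rw [e1 F, e1 G]
  calc Real.sqrt ((((P.L : ℝ) ^ k)⁻¹) ^ P.d * ∑ i, ∑ x, F i x ^ 2)
      ≤ Real.sqrt ((((P.L : ℝ) ^ k)⁻¹) ^ P.d * (c ^ 2 * ∑ j, ∑ x, G j x ^ 2)) :=
        Real.sqrt_le_sqrt (mul_le_mul_of_nonneg_left h hw)
    _ = c * Real.sqrt ((((P.L : ℝ) ^ k)⁻¹) ^ P.d * ∑ j, ∑ x, G j x ^ 2) := by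
        rw [show (((P.L : ℝ) ^ k)⁻¹) ^ P.d * (c ^ 2 * ∑ j, ∑ x, G j x ^ 2)
            = c ^ 2 * ((((P.L : ℝ) ^ k)⁻¹) ^ P.d * ∑ j, ∑ x, G j x ^ 2) by ring,
          Real.sqrt_mul' _ (by positivity), Real.sqrt_sq hc]

/-! ## §2 The scalar bounds for `G₀^{(μ)}` (member `(P, μ)` of the family, `m² = 0`, level `K`) -/

section Scalar

variable {a : ℝ} (ha : 0 < a) (μ : Fin P.d)
include ha

/-- `Σ_x (G₀^{(μ)}f)² ≤ γ₀^{−2} Σ_x f²`. [cite: Balaban1984PropagatorsI, Prop. 1.1 (1.89) p.33, p.39] -/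
theorem sq_G0_le (f : Site P 0 → ℝ) :
    ∑ x, (G0 P a 0 P.K μ *ᵥ f) x ^ 2 ≤ (gammaG0 P.d a)⁻¹ ^ 2 * ∑ x, f x ^ 2 := by
  have h := towerG0_ineq189_0 P ha (Pi.single μ f)
  rw [tG0_single, tl2_single, tl2_single] at h
  exact sq_le_of_sqrt_le (Finset.sum_nonneg fun _ _ => sq_nonneg _) (Finset.sum_nonneg fun _ _ => sq_nonneg _)
    h

/-- `Σ_λ Σ_x (∂_λG₀^{(μ)}f)² ≤ γ₀^{−2} Σ_x f²`. [cite: Balaban1984PropagatorsI, Prop. 1.1 (1.89) p.33, p.39] -/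
theorem sq_DG0_le (f : Site P 0 → ℝ) :
    ∑ ν, ∑ x, (deriv P 0 P.eps ν *ᵥ (G0 P a 0 P.K μ *ᵥ f)) x ^ 2 ≤ (gammaG0 P.d a)⁻¹ ^ 2 * ∑ x, f x ^ 2 := by
  have h := towerG0_ineq189_1 P ha (Pi.single μ f)
  simp only [tG0_single, tD_single] at h
  rw [tl2T_single, tl2_single] at h
  exact sq_le_of_sqrt_le (Finset.sum_nonneg fun _ _ => Finset.sum_nonneg fun _ _ => sq_nonneg _)
    (Finset.sum_nonneg fun _ _ => sq_nonneg _) h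

/-- `Σ_x (G₀^{(μ)}Σ_ν∂ᵀ_νJ_ν)² ≤ γ₀^{−2} Σ_νΣ_x J_ν²`. [cite: Balaban1984PropagatorsI, Prop. 1.1 (1.89) p.33, p.39] -/
theorem sq_G0div_le (J : Fin P.d → Site P 0 → ℝ) :
    ∑ x, (G0 P a 0 P.K μ *ᵥ (∑ ν, (deriv P 0 P.eps ν)ᵀ *ᵥ J ν)) x ^ 2 ≤ (gammaG0 P.d a)⁻¹ ^ 2 * ∑ ν, ∑ x, J ν x ^ 2 := by
  have h := towerG0_ineq189_2 P ha (fun ν => Pi.single μ (J ν))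
  rw [tDiv_single, tG0_single, tl2_single, tl2T_single] at h
  exact sq_le_of_sqrt_le (Finset.sum_nonneg fun _ _ => sq_nonneg _)
    (Finset.sum_nonneg fun _ _ => Finset.sum_nonneg fun _ _ => sq_nonneg _) h

/-- `Σ_λΣ_x (∂_λG₀^{(μ)}Σ_ν∂ᵀ_νJ_ν)² ≤ γ₀^{−2} Σ_νΣ_x J_ν²`. [cite: Balaban1984PropagatorsI, Prop. 1.1 (1.89) p.33, p.39] -/
theorem sq_DG0div_le (J : Fin P.d → Site P 0 → ℝ) :
    ∑ ν', ∑ x, (deriv P 0 P.eps ν' *ᵥ (G0 P a 0 P.K μ *ᵥ (∑ ν, (deriv P 0 P.eps ν)ᵀ *ᵥ J ν))) x ^ 2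
      ≤ (gammaG0 P.d a)⁻¹ ^ 2 * ∑ ν, ∑ x, J ν x ^ 2 := by
  have h := towerG0_ineq189_3 P ha (fun ν => Pi.single μ (J ν))
  simp only [tDiv_single, tG0_single, tD_single] at h
  rw [tl2T_single, tl2T_single] at h
  exact sq_le_of_sqrt_le (Finset.sum_nonneg fun _ _ => Finset.sum_nonneg fun _ _ => sq_nonneg _)
    (Finset.sum_nonneg fun _ _ => Finset.sum_nonneg fun _ _ => sq_nonneg _) h

/-- `Σ_{λλ′}Σ_x (∂_λ∂_{λ′}G₀^{(μ)}f)² ≤ γ₀^{−2} Σ_x f²`. [cite: Balaban1984PropagatorsI, Prop. 1.1 (1.89) p.33, p.39] -/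
theorem sq_DDG0_le (f : Site P 0 → ℝ) :
    ∑ p : Fin P.d × Fin P.d, ∑ x, (deriv P 0 P.eps p.1 *ᵥ (deriv P 0 P.eps p.2 *ᵥ (G0 P a 0 P.K μ *ᵥ f))) x ^ 2
      ≤ (gammaG0 P.d a)⁻¹ ^ 2 * ∑ x, f x ^ 2 := by
  have h := towerG0_ineq189_4 P ha (Pi.single μ f)
  simp only [tG0_single, tD_single] at h
  rw [tl2T_single, tl2_single] at h
  exact sq_le_of_sqrt_le (Finset.sum_nonneg fun _ _ => Finset.sum_nonneg fun _ _ => sq_nonneg _)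
    (Finset.sum_nonneg fun _ _ => sq_nonneg _) h

/-- **(1.90) for `G₀^{(μ)}`**: `γ₀·⟨f, (−Δ^ε + 1)f⟩ ≤ ⟨f, (Δ + aQ*Q)^{(μ)}f⟩`. [cite: Balaban1984PropagatorsI, Prop. 1.1 (1.90) p.33, p.39] -/
theorem form_G0_ineq190 (f : Site P 0 → ℝ) :
    gammaG0 P.d a * (f ⬝ᵥ ((H P 0 + 1) *ᵥ f)) ≤ f ⬝ᵥ (M0 P a 0 P.K μ *ᵥ f) := by
  have h := towerG0_ineq190 P ha (Pi.single μ f)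
  rw [dot_single_sum, dot_single_sum] at h
  have hH : hOp P 0 P.eps 1 = H P 0 + 1 := by
    rw [H, hOp, hOp, zero_smul, zero_add, one_smul, add_comm]
  rwa [hH] at h

end Scalar

/-! ## §3 The six norms and the forms of p37's setting; `B5.Prop11Printed` for the family of record -/

section Helpers

/-- `(∂_λ·G)f = ∂_λ(Gf)` at the top level. [cite: Balaban1984PropagatorsI, (1.89) p.33] -/
theorem dEta_mul_mulVec (G : Matrix (Site P 0) (Site P 0) ℝ) (ν : Fin P.d) (f : Site P 0 → ℝ) :
    (dEta P P.K ν * G) *ᵥ f = deriv P 0 P.eps ν *ᵥ (G *ᵥ f) := by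
  rw [← Matrix.mulVec_mulVec, dEta_top]

/-- `G∇*J = G(Σ_ν ∂ᵀ_ν J_ν)` at the top level. [cite: Balaban1984PropagatorsI, (1.89) p.33] -/
theorem opDiv_eq (G : Matrix (Site P 0) (Site P 0) ℝ) (J : Fin P.d → Site P 0 → ℝ) :
    opDiv P P.K G J = G *ᵥ (∑ ν, (deriv P 0 P.eps ν)ᵀ *ᵥ J ν) := by
  funext x
  rw [opDiv, mulVec_finset_sum, Finset.sum_apply]
  refine Finset.sum_congr rfl fun ν _ => ?_
  rw [opK1, ← Matrix.mulVec_mulVec, dEta_top]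

/-- `(∇G∇*J)_λ = ∂_λ G(Σ_ν ∂ᵀ_ν J_ν)` at the top level. [cite: Balaban1984PropagatorsI, (1.89) p.33] -/
theorem opDD_eq (G : Matrix (Site P 0) (Site P 0) ℝ) (J : Fin P.d → Site P 0 → ℝ) (ν' : Fin P.d) :
    opDD P P.K G J ν' = deriv P 0 P.eps ν' *ᵥ (G *ᵥ (∑ ν, (deriv P 0 P.eps ν)ᵀ *ᵥ J ν)) := by
  funext x
  rw [opDD, mulVec_finset_sum, mulVec_finset_sum, Finset.sum_apply]
  refine Finset.sum_congr rfl fun ν _ => ?_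
  rw [opKDD, ← Matrix.mulVec_mulVec, ← Matrix.mulVec_mulVec, dEta_top, dEta_top]

end Helpers

section Setting

variable {a : ℝ} (ha : 0 < a) (μ : Fin P.d)
include ha

/-- **(1.89) for the member `(P, μ)`, all six norms**: `opL2 n J ≤ γ₀^{−1}‖J‖`. [cite: Balaban1984PropagatorsI, Prop. 1.1 (1.89) p.33, p.39] -/
theorem opL2_le (n : Fin 6) (J : Fin P.d → Site P 0 → ℝ) :
    opL2 P P.K (G0 P a 0 P.K μ) n J ≤ (gammaG0 P.d a)⁻¹ * l2NormV P P.K J := by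
  have hγ : 0 ≤ (gammaG0 P.d a)⁻¹ := inv_nonneg.mpr (gammaG0_pos' ha.le).le
  rw [B5G0SettingTorus.l2NormV_eq_l2Fam]
  match n with
  | ⟨0, _⟩ =>
      show l2Fam P P.K (fun ν => G0 P a 0 P.K μ *ᵥ J ν) ≤ _
      refine l2Fam_le_of_sq P P.K _ _ hγ ?_
      rw [Finset.mul_sum]
      exact Finset.sum_le_sum fun ν _ => sq_G0_le P ha μ (J ν)
  | ⟨1, _⟩ =>
      show l2Fam P P.K (fun p : Fin P.d × Fin P.d => (dEta P P.K p.1 * G0 P a 0 P.K μ) *ᵥ J p.2) ≤ _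
      refine l2Fam_le_of_sq P P.K _ _ hγ ?_
      simp only [dEta_mul_mulVec]
      rw [Fintype.sum_prod_type, Finset.sum_comm, Finset.mul_sum]
      exact Finset.sum_le_sum fun ν _ => sq_DG0_le P ha μ (J ν)
  | ⟨2, _⟩ =>
      show l2Fam P P.K (fun _ : Unit => opDiv P P.K (G0 P a 0 P.K μ) J) ≤ _
      refine l2Fam_le_of_sq P P.K _ _ hγ ?_
      rw [Fintype.sum_unique, opDiv_eq]
      exact sq_G0div_le P ha μ J
  | ⟨3, _⟩ =>
      show l2Fam P P.K (opDD P P.K (G0 P a 0 P.K μ) J) ≤ _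
      refine l2Fam_le_of_sq P P.K _ _ hγ ?_
      simp only [opDD_eq]
      exact sq_DG0div_le P ha μ J
  | ⟨4, _⟩ =>
      show l2Fam P P.K (fun p : (Fin P.d × Fin P.d) × Fin P.d =>
          (dEta P P.K p.1.1 * dEta P P.K p.1.2 * G0 P a 0 P.K μ) *ᵥ J p.2) ≤ _
      refine l2Fam_le_of_sq P P.K _ _ hγ ?_
      have e : ∀ (p : (Fin P.d × Fin P.d) × Fin P.d),
          (dEta P P.K p.1.1 * dEta P P.K p.1.2 * G0 P a 0 P.K μ) *ᵥ J p.2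
            = deriv P 0 P.eps p.1.1 *ᵥ (deriv P 0 P.eps p.1.2 *ᵥ (G0 P a 0 P.K μ *ᵥ J p.2)) := by
        intro p
        rw [← Matrix.mulVec_mulVec, ← Matrix.mulVec_mulVec, dEta_top, dEta_top]
      simp only [e]
      rw [Fintype.sum_prod_type, Finset.sum_comm, Finset.mul_sum]
      exact Finset.sum_le_sum fun ν _ => sq_DDG0_le P ha μ (J ν)
  | ⟨5, _⟩ =>
      show (0 : ℝ) ≤ _
      exact mul_nonneg hγ (l2Fam_nonneg P P.K J)

/-- **(1.90) for the member `(P, μ)`**: `γ₀·formOp (lapEta + 1) f ≤ formOp (M0) f`. [cite: Balaban1984PropagatorsI, Prop. 1.1 (1.90) p.33, p.39] -/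
theorem formOp_ineq190 (f : Site P 0 → ℝ) :
    gammaG0 P.d a * formOp P P.K (lapEta P P.K + 1) f ≤ formOp P P.K (M0 P a 0 P.K μ) f := by
  unfold formOp
  rw [lapEta_top]
  have hw : 0 ≤ (((P.L : ℝ) ^ P.K)⁻¹) ^ P.d := by positivity
  have h := form_G0_ineq190 P ha μ f
  calc gammaG0 P.d a * ((((P.L : ℝ) ^ P.K)⁻¹) ^ P.d * (f ⬝ᵥ ((H P 0 + 1) *ᵥ f)))
      = (((P.L : ℝ) ^ P.K)⁻¹) ^ P.d * (gammaG0 P.d a * (f ⬝ᵥ ((H P 0 + 1) *ᵥ f))) := by ring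
    _ ≤ (((P.L : ℝ) ^ P.K)⁻¹) ^ P.d * (f ⬝ᵥ (M0 P a 0 P.K μ *ᵥ f)) := mul_le_mul_of_nonneg_left h hw

/-- **Proposition 1.1 for the G₀-setting of record, one member.** [cite: Balaban1984PropagatorsI, Prop. 1.1 p.33, p.39] -/
theorem prop11_g0Setting :
    (∀ (n : Fin 6) (J : (g0Setting P a 0 P.K μ).Loc),
        (g0Setting P a 0 P.K μ).l2op n J ≤ (gammaG0 P.d a)⁻¹ * (g0Setting P a 0 P.K μ).l2Norm J) ∧
      (∀ f : (g0Setting P a 0 P.K μ).Vec,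
        gammaG0 P.d a * (g0Setting P a 0 P.K μ).formΔI f ≤ (g0Setting P a 0 P.K μ).formΔa f) :=
  ⟨fun n J => opL2_le P ha μ n J, fun f => formOp_ineq190 P ha μ f⟩

end Setting

/-- **PROPOSITION 1.1 FOR G₀ («… and we have Proposition 1.1 for G₀.», p. 39) FOR THE TOWER FAMILY OF RECORD, BY NAME**: `B5.Prop11Printed (famG0Top d L a 0)`,
one constant `γ₀ = gammaG0 d a` for all tori of dimension `d` (every `m`, every `K ≥ 1`) and all directions `μ` — the
hypothesis `h11G0` of the Prop-1.2 chain discharged. [cite: Balaban1984PropagatorsI, Prop. 1.1 p.33, p.39 L29 («we have Proposition 1.1 for G₀»)] -/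
theorem prop11Printed_famG0Top (d L : ℕ) {a : ℝ} (ha : 0 < a) : B5.Prop11Printed (famG0Top d L a 0) := by
  refine ⟨gammaG0 d a, gammaG0_pos' ha.le, fun i => ?_⟩
  obtain ⟨P, hPd, hPL, hK, μ⟩ := i
  subst hPd
  exact prop11_g0Setting P ha μ


/-! ## §4 The located leaf `‖J‖ ≤ B|J|` for `supp J ⊂ Δ̃(y′)` for the tower settings (top level) -/

section LeSup

open Literature.MathematicalPhysics.QuantumFieldTheory.Balaban1983to89.B5Prop11Plancherel (Tor fine)
open Literature.MathematicalPhysics.QuantumFieldTheory.Balaban1983to89.B5SiteBridgeP12 (eFine eUnit inCube_K_iff one_le_nP)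
open Literature.MathematicalPhysics.QuantumFieldTheory.Balaban1983to89.B5G0BridgeP12 (embA embA_apply l2NormV_eq)
open Literature.MathematicalPhysics.QuantumFieldTheory.Balaban1983to89.B5GpSettingTorus (supNormV supNormV_nonneg supN_le_supNormV
  inCube)
open Literature.MathematicalPhysics.QuantumFieldTheory.Balaban1983to89.B5G0SettingTorus (opSetting)
open Literature.MathematicalPhysics.QuantumFieldTheory.Balaban1983to89.B5Ineq137Torus (supN le_supN)
open Literature.MathematicalPhysics.QuantumFieldTheory.Balaban1983to89.B5Prop12FieldsLattice (supNormL suppInL cubeT)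
open Literature.MathematicalPhysics.QuantumFieldTheory.Balaban1983to89.LatticeNorms (supNorm supNorm_le)
open Literature.MathematicalPhysics.QuantumFieldTheory.Balaban1983to89.B5SettingP12Weighted (sqEta latticeSettingP12W l2NormW_le_supNorm)

/-- the sup norm of the embedded source is at most p37's `|J|`. [cite: Balaban1984PropagatorsI, (1.108) p.35] -/
theorem supNormL_embA_le (J : Fin P.d → Site P 0 → ℝ) :
    supNormL (nP P) (MP P) (.vec (embA P J)) ≤ supNormV P J := by
  show supNorm Finset.univ (embA P J) ≤ supNormV P J
  refine supNorm_le (supNormV_nonneg J) fun b _ => ?_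
  obtain ⟨z, μ⟩ := b
  rw [embA_apply, Complex.norm_real, Real.norm_eq_abs]
  exact (le_supN P (J μ) _).trans (supN_le_supNormV J μ)

/-- a source supported in `Δ̃(y′)` embeds to a source supported in `cubeT (eUnit y′)`. [cite: Balaban1984PropagatorsI, p.35 (Δ̃(y′))] -/
theorem suppInL_embA (J : Fin P.d → Site P 0 → ℝ) (y' : Site P P.K) (hJ : ∀ ν x, J ν x ≠ 0 → inCube P P.K x y') :
    suppInL (nP P) (MP P) (.vec (embA P J)) (eUnit P y') := by
  intro b hb
  obtain ⟨z, μ⟩ := b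
  rw [embA_apply] at hb
  have h1 : J μ ((eFine P).symm z) ≠ 0 := fun h => hb (by rw [h, Complex.ofReal_zero])
  have h2 := (inCube_K_iff P ((eFine P).symm z) y').mp (hJ μ _ h1)
  rwa [Equiv.apply_symm_apply] at h2

/-- **`‖J‖ ≤ B|J|` for `supp J ⊂ Δ̃(y′)` FOR THE TOWER SOURCES AT THE TOP LEVEL, UNIFORM IN THE TORUS**: p37's weighted norm
`l2NormV P K J ≤ √(d³·3^d)·supNormV P J` whenever `supp J ⊂ Δ̃(y′)` (transport of `B5SettingP12Weighted.l2NormW_le_supNorm`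
through `eFine`). [cite: Balaban1984PropagatorsI, (1.132)/(1.133) p.39 with (1.108) p.35] -/
theorem l2NormV_le_supNormV (J : Fin P.d → Site P 0 → ℝ) (y' : Site P P.K) (hJ : ∀ ν x, J ν x ≠ 0 → inCube P P.K x y') :
    l2NormV P P.K J ≤ Real.sqrt ((P.d : ℝ) ^ 3 * 3 ^ P.d) * supNormV P J := by
  have h := l2NormW_le_supNorm (MP P) (nP P) (one_le_nP P) 1 P.K (.vec (embA P J)) (eUnit P y') (suppInL_embA P J y' hJ)
  change sqEta (nP P) P.d * B5Prop11Lattice.l2 (embA P J)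
    ≤ Real.sqrt ((P.d : ℝ) ^ 3 * 3 ^ P.d) * supNormL (nP P) (MP P) (.vec (embA P J)) at h
  rw [l2NormV_eq]
  exact h.trans (mul_le_mul_of_nonneg_left (supNormL_embA_le P J) (Real.sqrt_nonneg _))

/-- **the located leaf `l2_le_sup` of `B5Transfer133.CarrierFacts` / `B5Transfer132.PieceFacts132` for every tower setting
`opSetting P P.K G Gi`** (in particular `g0Setting`, and `gpSetting` at the top level which has the same carrier), with
`B = √(d³·3^d)`. [cite: Balaban1984PropagatorsI, (1.132)/(1.133) p.39 with (1.108) p.35] -/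
theorem l2_le_sup_opSetting (G Gi : Matrix (Site P 0) (Site P 0) ℝ) (J : (opSetting P P.K G Gi).Loc) (y' : (opSetting P P.K G Gi).Site)
    (hJ : (opSetting P P.K G Gi).suppIn J y') :
    (opSetting P P.K G Gi).l2Norm J ≤ Real.sqrt ((P.d : ℝ) ^ 3 * 3 ^ P.d) * (opSetting P P.K G Gi).supNorm J :=
  l2NormV_le_supNormV P J y' hJ

end LeSup

end

end Literature.MathematicalPhysics.QuantumFieldTheory.Balaban1983to89.B5Prop11G0Tower
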